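import Literature.NumberTheory.Automorphic.UnitaryGroupIntegralPointsReductionInert   -- ★ `valuation_galAdicCompletionMap_eq`; brings ★ `isCompact_subgroupOf_unitaryGroupOfForm`, ★ `glInt`
import Literature.NumberTheory.Automorphic.LocalUnitaryGroupCongr                     -- ★ `localNonsplitEquiv` (the one-place model `U(J)(F_v) ≃ₜ* U(σ_w, J_w)(E_w)`)
import Literature.LinearAlgebra.Matrix.Diagonalization                                -- ★ `isDiag_conj_of_commute_of_injective`, `exists_conj_eq_diagonal_of_nodup_roots`
import HarnessLib

/-!
# The centraliser of an elliptic regular element of torus type `(E¹_w)ᴺ` in a local unitary group is COMPACT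

Topic `NumberTheory/Automorphic`; namespace `Literature.NumberTheory.Automorphic.UnitaryGroup`.  THEOREMS ONLY (no definition, no instance, no
notation, no named fact, no `sorry`).  Cell `hodgecm-mathlib`, F0∕P3a N7-inert road (A-p06 map 84809157 §3), brick «(L2)-ELL» (A-p01 (g20)): it DISCHARGES
the instance binder `[CompactSpace ↥(Subgroup.centralizer {γ})]` carried by the unit-orbital-integral sockets ★ `UnitaryUnitOrbitalIntegralFixedPoints`,
★ `UnitaryUnitOrbitalIntegralLatticeCount`, ★ `UnitOrbitalIntegralFixedPointsPair` for the classes the (L3)∕(L5) counts are about: `γ_w = S · diag(d) · S⁻¹`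
with `d` injective and `σ_w(d_i) d_i = 1` (torus type `(E¹_w)ᴺ` at a non-split place `w ∣ v`).  HONEST LABEL: count-neutral plumbing; the converse
(«`Z(γ)` compact ⇒ anisotropic») and the other elliptic torus types are not claimed.  HC_CM is proved only modulo the printed citations until rung 0 closes.

THE ARGUMENT.  `x ∈ Z(γ)` ⇒ `S⁻¹ x S` is diagonal (★ `isDiag_conj_of_commute_of_injective`), `= diag(e)`.  Unitarity of `γ` forces the Gram matrix
`D = ᵗ(σ S) J S` of the eigenbasis to satisfy `D = diag(σ d) D diag(d)` (§1), so `D_{ij} (σ(d_i) d_j − 1) = 0`, and `σ(d_i) d_j ≠ 1` for `i ≠ j`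
(it equals `1 = σ(d_i) d_i` only if `d_j = d_i`): `D` is diagonal with non-zero diagonal (`det D ≠ 0`).  Unitarity of `x` gives `D = diag(σ e) D diag(e)`, hence
`σ(e_i) e_i = 1`, hence `v(e_i) ≤ 1` when `σ` preserves the valuation (§2) — for `x` AND `x⁻¹`.  So `S⁻¹ Z(γ) S ⊆ GL_N(𝒪)`, i.e. `Z(γ) ⊆ S · GL_N(𝒪) · S⁻¹`, a compact
set (★ `isCompact_glInt`, ★ `isCompact_subgroupOf_unitaryGroupOfForm`), and `Z(γ)` is closed (Mathlib `Set.isClosed_centralizer`) (§3).  §4 transports this to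
the tree's carriers `«local» E c N J v` and `(cmDatum L N H).Local v` along ★ `localNonsplitEquiv`, and §5 derives the eigen-data from the characteristic
polynomial (★ `exists_conj_eq_diagonal_of_nodup_roots`).

* §1 `transpose_map_mul_mul_eq_diagonal_mul_mul_diagonal`, `isDiag_transpose_map_mul_mul_of_conj_eq_diagonal`, `map_apply_mul_apply_eq_one_of_commute`.
* §2 `valuation_le_one_of_map_mul_self_eq_one`.
* §3 **`isCompact_centralizer_unitaryGroupOfForm_of_conj_eq_diagonal`** (abstract non-archimedean local field `E`, continuous valuation-preserving `σ`).
* §4 **`compactSpace_centralizer_local_of_conj_eq_diagonal`** (`E ∕ F` quadratic, non-split `w ∣ v`), **`compactSpace_centralizer_cmDatum_local_of_conj_eq_diagonal`** (CM).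
* §5 **`compactSpace_centralizer_cmDatum_local_of_nodup_roots`** (hypotheses on `charpoly γ_w` only: splits, simple roots, every root of `σ_w`-norm one).

References: [PlatonovRapinchuk1994] §3.1 Thm. 3.1 (a torus over a local field is anisotropic iff its points are compact), §5.1; [Rogawski1990] §3.6 p. 31 (torus
types of `U(3)`), §4.9 p. 55; [HornJohnson2013] Thm. 1.3.12; [CasselsFrohlichANT1967] Ch. VII §1.1.
-/

set_option autoImplicit false

noncomputable section

open Matrix ValuativeRel NumberField IsDedekindDomain
open Literature.LinearAlgebra.Matrix
open scoped MatrixGroups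

namespace Literature.NumberTheory.Automorphic.UnitaryGroup

/-! ## §1 Field algebra: the Gram matrix of an eigenbasis of a unitary element -/

section Algebra

variable {K : Type*} [Field K] {N : ℕ} (σ : K →+* K) (J : Matrix (Fin N) (Fin N) K)

/-- If `ᵗ(σx) J x = J` and `x S = S · diag(e)`, the Gram matrix `D = ᵗ(σS) J S` satisfies `D = diag(σ ∘ e) · D · diag(e)`.
[cite: HornJohnson2013, Thm. 1.3.12] [cite: PlatonovRapinchuk1994, §3.1] -/
theorem transpose_map_mul_mul_eq_diagonal_mul_mul_diagonal {x S : Matrix (Fin N) (Fin N) K} {e : Fin N → K}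
    (hxu : (x.map σ)ᵀ * J * x = J) (hxS : x * S = S * diagonal e) :
    (S.map σ)ᵀ * J * S = diagonal (fun i => σ (e i)) * ((S.map σ)ᵀ * J * S) * diagonal e := by
  have key : ((x * S).map σ)ᵀ * J * (x * S) = (S.map σ)ᵀ * ((x.map σ)ᵀ * J * x) * S := by
    simp only [Matrix.map_mul, Matrix.transpose_mul, Matrix.mul_assoc]
  rw [hxu] at key
  calc (S.map σ)ᵀ * J * S = ((x * S).map σ)ᵀ * J * (x * S) := key.symm
    _ = diagonal (fun i => σ (e i)) * ((S.map σ)ᵀ * J * S) * diagonal e := by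
      rw [hxS, Matrix.map_mul, Matrix.diagonal_map (map_zero σ), Matrix.transpose_mul, Matrix.diagonal_transpose]
      simp only [Matrix.mul_assoc]

/-- Entrywise: `D_{ij} = σ(e_i) · D_{ij} · e_j`. [cite: HornJohnson2013, Thm. 1.3.12] -/
theorem transpose_map_mul_mul_apply_eq {x S : Matrix (Fin N) (Fin N) K} {e : Fin N → K}
    (hxu : (x.map σ)ᵀ * J * x = J) (hxS : x * S = S * diagonal e) (i j : Fin N) :
    ((S.map σ)ᵀ * J * S) i j = σ (e i) * ((S.map σ)ᵀ * J * S) i j * e j := by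
  have h := congrFun (congrFun (transpose_map_mul_mul_eq_diagonal_mul_mul_diagonal σ J hxu hxS) i) j
  rwa [Matrix.mul_diagonal, Matrix.diagonal_mul] at h

/-- **The Gram matrix of an eigenbasis of a unitary element with `σ(d_i) d_j ≠ 1 (i ≠ j)` is diagonal**: for `A ∈ U(σ, J)` with `S⁻¹ A S = diag(d)`,
`D = ᵗ(σS) J S` has `D_{ij} = 0` for `i ≠ j`. [cite: HornJohnson2013, Thm. 1.3.12] [cite: PlatonovRapinchuk1994, §3.1] -/
theorem isDiag_transpose_map_mul_mul_of_conj_eq_diagonal {A S : Matrix (Fin N) (Fin N) K} (hS : IsUnit S.det) {d : Fin N → K}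
    (hA : S⁻¹ * A * S = diagonal d) (hAu : (A.map σ)ᵀ * J * A = J) (hd : ∀ i j, i ≠ j → σ (d i) * d j ≠ 1) :
    ((S.map σ)ᵀ * J * S).IsDiag := by
  intro i j hij
  have hAS : A * S = S * diagonal d := (inv_mul_mul_eq_iff_mul_eq_mul hS).1 hA
  have h := transpose_map_mul_mul_apply_eq σ J hAu hAS i j
  have h' : ((S.map σ)ᵀ * J * S) i j * (σ (d i) * d j - 1) = 0 := by
    rw [mul_sub, mul_one, sub_eq_zero, ← mul_assoc, mul_comm (((S.map σ)ᵀ * J * S) i j)]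
    exact h.symm
  exact (mul_eq_zero.1 h').resolve_right (sub_ne_zero.2 (hd i j hij))

/-- For `d` injective with `σ(d_i) d_i = 1` for all `i`: `σ(d_i) d_j ≠ 1` whenever `i ≠ j`. [cite: PlatonovRapinchuk1994, §3.1] -/
theorem map_apply_mul_apply_ne_one_of_injective {d : Fin N → K} (hd : Function.Injective d) (hd1 : ∀ i, σ (d i) * d i = 1)
    (i j : Fin N) (hij : i ≠ j) : σ (d i) * d j ≠ 1 := by
  intro h
  have hσ0 : σ (d i) ≠ 0 := fun h0 => by simpa [h0] using hd1 i
  exact hij (hd (mul_left_cancel₀ hσ0 ((hd1 i).trans h.symm)))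

/-- The diagonal entries of the (diagonal, invertible) Gram matrix are non-zero. [cite: HornJohnson2013, Thm. 1.3.12] -/
theorem transpose_map_mul_mul_apply_ne_zero {A S : Matrix (Fin N) (Fin N) K} (hS : IsUnit S.det) (hJ : IsUnit J.det) {d : Fin N → K}
    (hA : S⁻¹ * A * S = diagonal d) (hAu : (A.map σ)ᵀ * J * A = J) (hd : ∀ i j, i ≠ j → σ (d i) * d j ≠ 1) (i : Fin N) :
    ((S.map σ)ᵀ * J * S) i i ≠ 0 := by
  have hD := isDiag_transpose_map_mul_mul_of_conj_eq_diagonal σ J hS hA hAu hd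
  have hdet : ((S.map σ)ᵀ * J * S).det ≠ 0 := by
    rw [Matrix.det_mul, Matrix.det_mul, Matrix.det_transpose, ← RingHom.mapMatrix_apply, ← RingHom.map_det]
    exact mul_ne_zero (mul_ne_zero ((map_ne_zero σ).2 hS.ne_zero) hJ.ne_zero) hS.ne_zero
  rw [← (Matrix.isDiag_iff_diagonal_diag _).1 hD, Matrix.det_diagonal] at hdet
  exact (Finset.prod_ne_zero_iff.1 hdet) i (Finset.mem_univ i)

/-- **Norm one on the diagonal**: for `A ∈ U(σ, J)` (`J` invertible) with `S⁻¹ A S = diag(d)`, `d` injective, `σ(d_i) d_i = 1`, every `x ∈ U(σ, J)` commuting with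
`A` has `S⁻¹ x S = diag(e)` with `σ(e_i) e_i = 1`. [cite: HornJohnson2013, Thm. 1.3.12] [cite: PlatonovRapinchuk1994, §3.1 Thm. 3.1] -/
theorem map_apply_mul_apply_eq_one_of_commute {A S : Matrix (Fin N) (Fin N) K} (hS : IsUnit S.det) (hJ : IsUnit J.det) {d : Fin N → K}
    (hd : Function.Injective d) (hd1 : ∀ i, σ (d i) * d i = 1) (hA : S⁻¹ * A * S = diagonal d) (hAu : (A.map σ)ᵀ * J * A = J)
    {x : Matrix (Fin N) (Fin N) K} (hxu : (x.map σ)ᵀ * J * x = J) (hAx : A * x = x * A) (i : Fin N) :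
    (S⁻¹ * x * S).IsDiag ∧ σ ((S⁻¹ * x * S) i i) * (S⁻¹ * x * S) i i = 1 := by
  have hy : (S⁻¹ * x * S).IsDiag := isDiag_conj_of_commute_of_injective hS hd hA hAx
  refine ⟨hy, ?_⟩
  have hxS : x * S = S * diagonal (S⁻¹ * x * S).diag := by
    rw [(Matrix.isDiag_iff_diagonal_diag _).1 hy, ← Matrix.mul_assoc, ← Matrix.mul_assoc, Matrix.mul_nonsing_inv S hS, Matrix.one_mul]
  have h := transpose_map_mul_mul_apply_eq σ J hxu hxS i i
  have hne := transpose_map_mul_mul_apply_ne_zero σ J hS hJ hA hAu (map_apply_mul_apply_ne_one_of_injective σ hd hd1) i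
  rw [Matrix.diag_apply] at h
  have h' : ((S.map σ)ᵀ * J * S) i i * (σ ((S⁻¹ * x * S) i i) * (S⁻¹ * x * S) i i) = ((S.map σ)ᵀ * J * S) i i * 1 := by
    rw [mul_one, ← mul_assoc, mul_comm (((S.map σ)ᵀ * J * S) i i)]
    exact h.symm
  exact mul_left_cancel₀ hne h'

end Algebra

/-! ## §2 Valued fields: `σ(e) e = 1` with `σ` valuation-preserving forces `v(e) ≤ 1` -/

section Valued

variable {K : Type*} [Field K] [ValuativeRel K] (σ : K →+* K)

/-- `σ(e) · e = 1` and `v ∘ σ = v` ⇒ `v(e) ≤ 1` (indeed `v(e)² = 1`). [cite: CasselsFrohlichANT1967, Ch. VII §1.1] -/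
theorem valuation_le_one_of_map_mul_self_eq_one (hσ : ∀ x, valuation K (σ x) = valuation K x) {e : K} (h : σ e * e = 1) :
    valuation K e ≤ 1 := by
  have hv := congrArg (valuation K) h
  rw [map_mul, map_one, hσ] at hv
  rcases le_total (valuation K e) 1 with hle | hge
  · exact hle
  · calc valuation K e = valuation K e * 1 := (mul_one _).symm
      _ ≤ valuation K e * valuation K e := mul_le_mul' le_rfl hge
      _ = 1 := hv

end Valued

/-! ## §3 Abstract non-archimedean local field: `Z_{U(σ,J)}(γ)` is compact for `γ` of torus type `(E¹)ᴺ` -/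

section LocalField

variable {E : Type*} [Field E] [ValuativeRel E] [TopologicalSpace E] [IsNonarchimedeanLocalField E] {n : ℕ}
  (σ : E →+* E) (J : Matrix (Fin n) (Fin n) E)

/-- **`Z(γ)` IS COMPACT for `γ ∈ U(σ, J)(E)` of torus type `(E¹)ᴺ`** (`E` a non-archimedean local field, `σ` continuous and valuation-preserving, `J`
invertible): if `S⁻¹ γ S = diag(d)` with `d` injective and `σ(d_i) d_i = 1`, then `Z_{U(σ,J)}(γ) ⊆ S · GL_N(𝒪) · S⁻¹` is compact.
[cite: PlatonovRapinchuk1994, §3.1 Thm. 3.1] [cite: Rogawski1990, §3.6 p. 31] -/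
theorem isCompact_centralizer_unitaryGroupOfForm_of_conj_eq_diagonal (hσ : Continuous σ) (hσv : ∀ x, valuation E (σ x) = valuation E x)
    (hJ : IsUnit J.det) (g : ↥(unitaryGroupOfForm σ J)) {S : Matrix (Fin n) (Fin n) E} (hS : IsUnit S.det) {d : Fin n → E}
    (hd : Function.Injective d) (hd1 : ∀ i, σ (d i) * d i = 1)
    (hg : S⁻¹ * ((g : GL (Fin n) E) : Matrix (Fin n) (Fin n) E) * S = diagonal d) :
    IsCompact ((Subgroup.centralizer ({g} : Set ↥(unitaryGroupOfForm σ J)) : Subgroup ↥(unitaryGroupOfForm σ J)) :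
      Set ↥(unitaryGroupOfForm σ J)) := by
  classical
  haveI : T2Space E := (Literature.NumberTheory.GaloisRepresentations.IsNonarchimedeanLocalField.isLocalField E).toT2Space
  have hSu : IsUnit S := (Matrix.isUnit_iff_isUnit_det S).2 hS
  have hTval : ((hSu.unit : GL (Fin n) E) : Matrix (Fin n) (Fin n) E) = S := hSu.unit_spec
  have hTinv : ((hSu.unit⁻¹ : GL (Fin n) E) : Matrix (Fin n) (Fin n) E) = S⁻¹ := by
    rw [Matrix.coe_units_inv, hTval]
  -- the compact subgroup `S · GL_N(𝒪) · S⁻¹` of `GL_N(E)`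
  have hcont : Continuous ((MulAut.conj hSu.unit).toMonoidHom : GL (Fin n) E → GL (Fin n) E) := by
    have hfun : ((MulAut.conj hSu.unit).toMonoidHom : GL (Fin n) E → GL (Fin n) E) = fun x => hSu.unit * x * hSu.unit⁻¹ := by
      funext x; rfl
    rw [hfun]
    fun_prop
  have hHc : IsCompact (((glInt n E).map (MulAut.conj hSu.unit).toMonoidHom : Subgroup (GL (Fin n) E)) : Set (GL (Fin n) E)) := by
    rw [Subgroup.coe_map]
    exact (isCompact_glInt n E).image hcont
  refine (isCompact_subgroupOf_unitaryGroupOfForm σ J hσ hHc).of_isClosed_subset (Set.isClosed_centralizer ({g} : Set ↥(unitaryGroupOfForm σ J)))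
    fun x hx => ?_
  -- `x ∈ Z(g)`: `S⁻¹ x S ∈ GL_N(𝒪)`
  have hgu : ((((g : GL (Fin n) E) : Matrix (Fin n) (Fin n) E)).map σ)ᵀ * J * ((g : GL (Fin n) E) : Matrix (Fin n) (Fin n) E) = J :=
    mem_unitaryGroupOfForm_iff.1 g.2
  have hxg : (g : GL (Fin n) E) * (x : GL (Fin n) E) = (x : GL (Fin n) E) * (g : GL (Fin n) E) := by
    have h := (Subgroup.mem_centralizer_iff.1 hx) g (Set.mem_singleton g)
    exact_mod_cast congrArg (fun y : ↥(unitaryGroupOfForm σ J) => (y : GL (Fin n) E)) h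
  have hint : ∀ y : ↥(unitaryGroupOfForm σ J), (g : GL (Fin n) E) * (y : GL (Fin n) E) = (y : GL (Fin n) E) * (g : GL (Fin n) E) →
      ∀ i j, (S⁻¹ * ((y : GL (Fin n) E) : Matrix (Fin n) (Fin n) E) * S) i j ∈ 𝒪[E] := by
    intro y hy i j
    have hyu : ((((y : GL (Fin n) E) : Matrix (Fin n) (Fin n) E)).map σ)ᵀ * J * ((y : GL (Fin n) E) : Matrix (Fin n) (Fin n) E) = J :=
      mem_unitaryGroupOfForm_iff.1 y.2
    have hgy : ((g : GL (Fin n) E) : Matrix (Fin n) (Fin n) E) * ((y : GL (Fin n) E) : Matrix (Fin n) (Fin n) E) =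
        ((y : GL (Fin n) E) : Matrix (Fin n) (Fin n) E) * ((g : GL (Fin n) E) : Matrix (Fin n) (Fin n) E) := by
      rw [← Units.val_mul, ← Units.val_mul, hy]
    obtain ⟨hdiag, hone⟩ := map_apply_mul_apply_eq_one_of_commute σ J hS hJ hd hd1 hg hgu hyu hgy i
    by_cases hij : i = j
    · subst hij
      exact (Valuation.mem_integer_iff _ _).2 (valuation_le_one_of_map_mul_self_eq_one σ hσv hone)
    · rw [hdiag hij]
      exact zero_mem _
  rw [SetLike.mem_coe, Subgroup.mem_subgroupOf, Subgroup.mem_map]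
  refine ⟨hSu.unit⁻¹ * (x : GL (Fin n) E) * hSu.unit, ?_, ?_⟩
  · rw [mem_glInt_iff]
    refine ⟨fun i j => ?_, fun i j => ?_⟩
    · rw [Units.val_mul, Units.val_mul, hTval, hTinv]
      exact hint x hxg i j
    · have hinv : (hSu.unit⁻¹ * (x : GL (Fin n) E) * hSu.unit)⁻¹ =
          hSu.unit⁻¹ * ((x⁻¹ : ↥(unitaryGroupOfForm σ J)) : GL (Fin n) E) * hSu.unit := by
        rw [Subgroup.coe_inv, _root_.mul_inv_rev, _root_.mul_inv_rev, inv_inv, mul_assoc]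
      rw [hinv, Units.val_mul, Units.val_mul, hTval, hTinv]
      refine hint x⁻¹ ?_ i j
      rw [Subgroup.coe_inv]
      exact (Commute.inv_right hxg).eq
  · rw [MulEquiv.coe_toMonoidHom, MulAut.conj_apply]
    group

end LocalField

/-! ## §4 Transport to the tree's carriers `«local» E c N J v` and `(cmDatum L N H).Local v` at a non-split place -/

section Transport

/-- Compactness of centralisers transports along a topological group isomorphism: `Z(γ) = e⁻¹(Z(e γ))`. [cite: BourbakiGT1, Ch. III §2] -/
private theorem compactSpace_centralizer_of_isCompact_centralizer_map {G G' : Type*} [Group G] [Group G'] [TopologicalSpace G] [TopologicalSpace G']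
    (e : G ≃ₜ* G') (γ : G) (h : IsCompact ((Subgroup.centralizer ({e γ} : Set G')) : Set G')) :
    CompactSpace ↥(Subgroup.centralizer ({γ} : Set G)) := by
  refine isCompact_iff_compactSpace.1 ?_
  have hset : ((Subgroup.centralizer ({γ} : Set G)) : Set G) = e ⁻¹' ((Subgroup.centralizer ({e γ} : Set G')) : Set G') := by
    ext x
    simp only [Set.mem_preimage, SetLike.mem_coe, Subgroup.mem_centralizer_iff, Set.mem_singleton_iff, forall_eq]
    constructor
    · intro hx
      rw [← map_mul, hx, map_mul]
    · intro hx
      exact e.injective (by rw [map_mul, map_mul, hx])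
  rw [hset]
  exact e.toHomeomorph.isCompact_preimage.2 h

variable {F E : Type} [Field F] [NumberField F] [Field E] [NumberField E] [Algebra F E] [Algebra.IsQuadraticExtension F E]
  (c : E ≃ₐ[F] E) {N : ℕ} (J : Matrix (Fin N) (Fin N) E) {v : HeightOneSpectrum (𝓞 F)}

/-- **`Z(γ) ⊆ U(J)(F_v)` IS COMPACT for `γ` of torus type `(E¹_w)ᴺ` at a NON-SPLIT place** (`E ∕ F` quadratic, `c • w = w`, `J` invertible at `w`): if the
one-place avatar `γ_w ∈ U(σ_w, J_w)(E_w)` (★ `localNonsplitEquiv`) has `S⁻¹ γ_w S = diag(d)` with `d` injective and `σ_w(d_i) d_i = 1`, then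
`CompactSpace Z(γ)` (§3 with `σ_w` continuous ★ `continuous_galAdicCompletionMap` and valuation-preserving ★ `valuation_galAdicCompletionMap_eq`).
[cite: PlatonovRapinchuk1994, §3.1 Thm. 3.1; §5.1] [cite: Rogawski1990, §3.6 p. 31] -/
theorem compactSpace_centralizer_local_of_conj_eq_diagonal (hc : c ≠ 1) (w : PlacesOver E v) (hw : c • w.1 = w.1)
    (hJw : IsUnit (placeForm J w.1)) (γ : «local» E c N J v) {S : Matrix (Fin N) (Fin N) (w.1.adicCompletion E)} (hS : IsUnit S.det)
    {d : Fin N → w.1.adicCompletion E} (hd : Function.Injective d) (hd1 : ∀ i, galAdicCompletionMap (L := E) c hw (d i) * d i = 1)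
    (hγ : S⁻¹ * (((localNonsplitEquiv c J hc w hw γ : unitaryGroupOfForm (galAdicCompletionMap (L := E) c hw) (placeForm J w.1)) :
        GL (Fin N) (w.1.adicCompletion E)) : Matrix (Fin N) (Fin N) (w.1.adicCompletion E)) * S = diagonal d) :
    CompactSpace ↥(Subgroup.centralizer ({γ} : Set («local» E c N J v))) :=
  compactSpace_centralizer_of_isCompact_centralizer_map (localNonsplitEquiv c J hc w hw) γ
    (isCompact_centralizer_unitaryGroupOfForm_of_conj_eq_diagonal _ _ (continuous_galAdicCompletionMap (L := E) c hw)
      (valuation_galAdicCompletionMap_eq c v w hw) ((Matrix.isUnit_iff_isUnit_det _).1 hJw) _ hS hd hd1 hγ)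

variable (L : Type) [Field L] [NumberField L] [IsCMField L] (N : ℕ) (H : Matrix (Fin N) (Fin N) L)

/-- **CM dress**: for `γ ∈ U(H)(L⁺_v)` (`(cmDatum L N H).Local v`) at a non-split place `w ∣ v` with `H` invertible at `w`, eigen-data `S⁻¹ γ_w S = diag(d)`, `d`
injective, `c_w(d_i) d_i = 1` ⇒ `CompactSpace Z(γ)` — the instance binder of ★ `classOrbitalIntegral_indicator_cmLocalIntegralLevel_eq_natCard_fixedBy`,
★ `…_eq_ncard_selfDual`, ★ `…_prod_eq_natCard_fixedBy_fst`. [cite: PlatonovRapinchuk1994, §3.1 Thm. 3.1; §5.1] [cite: Rogawski1990, §3.6 p. 31] -/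
theorem compactSpace_centralizer_cmDatum_local_of_conj_eq_diagonal {v : HeightOneSpectrum (𝓞 ↥(maximalRealSubfield L))}
    (w : PlacesOver L v) (hw : IsCMField.complexConj L • w.1 = w.1) (hHw : IsUnit (placeForm H w.1)) (γ : (cmDatum L N H).Local v)
    {S : Matrix (Fin N) (Fin N) (w.1.adicCompletion L)} (hS : IsUnit S.det) {d : Fin N → w.1.adicCompletion L} (hd : Function.Injective d)
    (hd1 : ∀ i, galAdicCompletionMap (L := L) (IsCMField.complexConj L) hw (d i) * d i = 1)
    (hγ : S⁻¹ * (((localNonsplitEquiv (IsCMField.complexConj L) H (IsCMField.complexConj_ne_one L) w hw γ :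
        unitaryGroupOfForm (galAdicCompletionMap (L := L) (IsCMField.complexConj L) hw) (placeForm H w.1)) : GL (Fin N) (w.1.adicCompletion L)) :
        Matrix (Fin N) (Fin N) (w.1.adicCompletion L)) * S = diagonal d) :
    CompactSpace ↥(Subgroup.centralizer ({γ} : Set ((cmDatum L N H).Local v))) :=
  compactSpace_centralizer_local_of_conj_eq_diagonal (IsCMField.complexConj L) H (IsCMField.complexConj_ne_one L) w hw hHw γ hS hd hd1 hγ

/-! ## §5 The eigen-data from the characteristic polynomial -/

/-- **Intrinsic form**: if the characteristic polynomial of `γ_w` SPLITS over `L_w` with SIMPLE roots, each of `c_w`-norm one (`c_w(μ) μ = 1`), then `Z(γ)` is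
compact (★ `exists_conj_eq_diagonal_of_nodup_roots` supplies the eigenbasis). [cite: HornJohnson2013, Thm. 1.3.9] [cite: PlatonovRapinchuk1994, §3.1 Thm. 3.1] -/
theorem compactSpace_centralizer_cmDatum_local_of_nodup_roots {v : HeightOneSpectrum (𝓞 ↥(maximalRealSubfield L))}
    (w : PlacesOver L v) (hw : IsCMField.complexConj L • w.1 = w.1) (hHw : IsUnit (placeForm H w.1)) (γ : (cmDatum L N H).Local v)
    (hsplit : ((((localNonsplitEquiv (IsCMField.complexConj L) H (IsCMField.complexConj_ne_one L) w hw γ :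
        unitaryGroupOfForm (galAdicCompletionMap (L := L) (IsCMField.complexConj L) hw) (placeForm H w.1)) : GL (Fin N) (w.1.adicCompletion L)) :
        Matrix (Fin N) (Fin N) (w.1.adicCompletion L))).charpoly.Splits)
    (hnodup : ((((localNonsplitEquiv (IsCMField.complexConj L) H (IsCMField.complexConj_ne_one L) w hw γ :
        unitaryGroupOfForm (galAdicCompletionMap (L := L) (IsCMField.complexConj L) hw) (placeForm H w.1)) : GL (Fin N) (w.1.adicCompletion L)) :
        Matrix (Fin N) (Fin N) (w.1.adicCompletion L))).charpoly.roots.Nodup)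
    (h1 : ∀ μ ∈ ((((localNonsplitEquiv (IsCMField.complexConj L) H (IsCMField.complexConj_ne_one L) w hw γ :
        unitaryGroupOfForm (galAdicCompletionMap (L := L) (IsCMField.complexConj L) hw) (placeForm H w.1)) : GL (Fin N) (w.1.adicCompletion L)) :
        Matrix (Fin N) (Fin N) (w.1.adicCompletion L))).charpoly.roots, galAdicCompletionMap (L := L) (IsCMField.complexConj L) hw μ * μ = 1) :
    CompactSpace ↥(Subgroup.centralizer ({γ} : Set ((cmDatum L N H).Local v))) := by
  obtain ⟨S, d, hS, hSd, hdm⟩ := exists_conj_eq_diagonal_of_nodup_roots _ hsplit hnodup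
  have hmem : ∀ i, d i ∈ ((((localNonsplitEquiv (IsCMField.complexConj L) H (IsCMField.complexConj_ne_one L) w hw γ :
        unitaryGroupOfForm (galAdicCompletionMap (L := L) (IsCMField.complexConj L) hw) (placeForm H w.1)) : GL (Fin N) (w.1.adicCompletion L)) :
        Matrix (Fin N) (Fin N) (w.1.adicCompletion L))).charpoly.roots := fun i => by
    rw [← hdm]
    exact Multiset.mem_map_of_mem d (Finset.mem_univ_val i)
  have hmap : (Finset.univ.val.map d).Nodup := by
    rw [hdm]
    exact hnodup
  have hd : Function.Injective d := fun i j hij =>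
    Multiset.inj_on_of_nodup_map hmap i (Finset.mem_univ_val i) j (Finset.mem_univ_val j) hij
  exact compactSpace_centralizer_cmDatum_local_of_conj_eq_diagonal L N H w hw hHw γ hS hd (fun i => h1 (d i) (hmem i)) hSd

end Transport

end Literature.NumberTheory.Automorphic.UnitaryGroup

end
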